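import Summits.NavierStokesRegularity.NavierStokesRegularity.Theses.SlicedKelvin
import HarnessLib.Audit

/-!
# Skeleton of the crux `SlicedKelvin.PlanarFluxAPriori` — line `reanchored`
(strategist RESHAPE of line `birth`: the Duhamel clock moved to `t₀ = T/2`, the ε-term split off)

(crux item `stmt-NavierStokesRegularity-15600`, rank 2, route `route-NavierStokesRegularity-SlicedKelvin`;
author `planner-cstrat-stmt-NavierStokesRegularity-15600-0` (crux-strategist), 2026-08-17. Companion card
`Lines/reanchored.md`; census `STRATEGY-CENSUS.md` §D.)

THE CUT. Same engine as `birth` (fold law ⇒ 1-D heat subsolution in the height ⇒ Duhamel domination),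
but (i) the comparison starts at a POSITIVE time `t₀` (here `T/2`) instead of `0`, so the window `[0,T/2]`
is paid by decay persistence alone (`stub_shortTimeFlux`) and the budget never sees the `t → 0⁺` end, where
Schwartz data may carry infinite fold complexity (Disproof.lean §C2, §D4(iii)–(iv): `Σ⁺₀(0) = +∞` is
admissible, and the nodal-area-in-time estimate needed near `t = 0` is not in print); and (ii) the
ε-REGULARISATION TERM `−ε²∂ₙuₙ/F_ε(f)` of the fold density is split off the budget functional into its own
provable stub (`stub_epsTermVanishes`: its positive part is `≤ ε(∂ₙuₙ)⁻`, so the term is `O(ε)` once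
`∇u(τ) ∈ L¹(ℝ³)` uniformly on `[t₀,t]` — quartic decay of `∇u`, one power more than the landed cubic
bootstrap; Disproof.lean §A5/§D4(ii) show this term is exactly where the energy class is load-bearing for
`birth`'s stub). What is left, `stub_positiveTimeFoldBudget`, is the PURE fold-creation content: the
Duhamel functional of the positive part of `−uₙ F_ε''(f) ω_∥·∇_∥f` alone, from `t₀`, bounded uniformly in
frames and `t ∈ [t₀,T)`; its `ε → 0⁺` limit on generic slices is the geometric creation rate
`2∫_{Z}(uₙ ω·N)⁻ dH²` on the fold surface `Z = {ω·n = 0}` (lead's STUB3-ANALYSIS (★)), finite at each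
positive time by analyticity. It carries 100 % of the open difficulty of the crux (census §D: it is the
crux re-clothed, exactly as `birth`'s stub 3 is) — this line only strips two provable-now sub-obligations
and one possibly-false-at-the-margin artefact (`t = 0`) off the XL stub. NOT a competing strategy.

STUBS: `stub_shortTimeFlux` [S/M: decay persistence (landed p156374) + the plane integral of
`(1+|y|)⁻³`], `stub_reanchoredDomination` [M/L: re-run the landed assembly
`stub_heatKernelDomination_of_foldLawSubsolution` with the clock shifted to `t₀` (time-translate the
package `FoldLawSubsolution`, apply `heat_subsolution_duhamel_bound_iSup` on `[t₀,t]`, Fubini over the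
foliation, `ε → 0⁺`), splitting `ofReal(s_ε) ≤ ofReal(fold part) + ofReal(−eps part)` and
`liminf(a+b) ≤ liminf a + limsup b` in `ℝ≥0∞`], `stub_epsTermVanishes` [L: quartic decay of `∇u` on
`[t₀,t] ⊂ (0,T)` + `∫_{t₀}^t (ν(t−τ))^{-1/2}dτ < ∞`], `stub_positiveTimeFoldBudget` [XL, OPEN].

COMPOSITION. `planarFluxAPriori_of_stubs` (closed; `M := ↑(A + C·B)` with `t₀ = T/2`) and
`PlanarFluxAPriori_of : Theses.SlicedKelvin.PlanarFluxAPriori` (A12 by-name form).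

DISPROOF USED (Cruxes/PlanarFluxAPriori/Disproof.lean, cdisprove c1): A1 (energy class) is used in
`stub_shortTimeFlux`/`stub_epsTermVanishes`/the domination (decay), as it must; A5 (ε-term load-bearing
without the energy class) is answered by isolating that term in `stub_epsTermVanishes` with the decay
hypothesis explicit in the class; C2/D4(iii) (infinite initial fold complexity) is dodged by construction
(`t₀ > 0`); D4(iv) (nodal-area gap for short times) no longer arises. No stub is an instance of the landed
Negative lemmas (`FalseWithoutEnergyClass`, `FoldCreationBudgetFalseWithoutEnergyClass`,
`EpsFoldLawFalseWithoutDivFree`): every stub keeps the full class hypotheses.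
-/

noncomputable section

namespace Summit.NavierStokesRegularity.NavierStokesRegularity.Cruxes.PlanarFluxAPriori.Reanchored

set_option linter.unusedVariables false
set_option linter.dupNamespace false

/-- **stub 1 — `stub_shortTimeFlux` [S/M].** On every compact initial window `[0,t₀]`, `t₀ < T`, the planar
flux is bounded uniformly over frames and heights (cubic decay of `Du` persists on `[0,t₀]`, landed
`stub_decayPersistence`; then `|curl u·n| ≤ 2‖Du‖ ≤ 2C₀(1+‖x‖)⁻³` and `‖R(y,c)‖ ≥ ‖y‖`). -/
theorem stub_shortTimeFlux :
      ∀ (ν T : ℝ), 0 < ν → 0 < T → ∀ (u : ℝ → EuclideanSpace ℝ (Fin 3) → EuclideanSpace ℝ (Fin 3)) (p : ℝ →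
      EuclideanSpace ℝ (Fin 3) → ℝ), Literature.Analysis.FluidPDE.IsClassicalNSSolutionOn (Set.Ico 0 T) ν 0
      u p → Literature.Analysis.FluidPDE.IsLerayHopfOn T ν 0 (u 0) u →
      Literature.Analysis.FluidPDE.HasRapidSpatialDecay (u 0) → ∀ t₀ ∈ Set.Ico 0 T, ∃ A : NNReal, ∀ s ∈
      Set.Icc 0 t₀, ∀ (R : EuclideanSpace ℝ (Fin 3) ≃ₗᵢ[ℝ] EuclideanSpace ℝ (Fin 3)) (c : ℝ), ∫⁻ y :
      EuclideanSpace ℝ (Fin 2), ‖inner ℝ (Literature.Analysis.FluidPDE.curl (u s) (R (WithLp.toLp 2 ![y 0,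
      y 1, c]))) (R (EuclideanSpace.single 2 1))‖ₑ ≤ (A : ENNReal) := by
  sorry

/-- **stub 2 — `stub_reanchoredDomination` [M/L].** Heat-kernel domination from a POSITIVE anchor `t₀`:
`Φ(t;R,c) ≤ ⨆_{c'} Φ(t₀;R,c') + C·(liminf_ε FOLD_ε(t₀,t) + limsup_ε EPS_ε(t₀,t))`, `C = (4π)^{-1/2}`, where
`FOLD_ε` is the Duhamel functional of the positive part of the fold term alone and `EPS_ε` that of the
positive part of minus the ε-term (`ofReal` takes positive parts). -/
theorem stub_reanchoredDomination :
      ∃ C : NNReal, ∀ (ν T : ℝ), 0 < ν → 0 < T → ∀ (u : ℝ → EuclideanSpace ℝ (Fin 3) → EuclideanSpace ℝ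
      (Fin 3)) (p : ℝ → EuclideanSpace ℝ (Fin 3) → ℝ), Literature.Analysis.FluidPDE.IsClassicalNSSolutionOn
      (Set.Ico 0 T) ν 0 u p → Literature.Analysis.FluidPDE.IsLerayHopfOn T ν 0 (u 0) u →
      Literature.Analysis.FluidPDE.HasRapidSpatialDecay (u 0) → ∀ t₀ ∈ Set.Ioo 0 T, ∀ t ∈ Set.Ico t₀ T, ∀
      (R : EuclideanSpace ℝ (Fin 3) ≃ₗᵢ[ℝ] EuclideanSpace ℝ (Fin 3)) (c : ℝ), ∫⁻ y : EuclideanSpace ℝ (Fin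
      2), ‖inner ℝ (Literature.Analysis.FluidPDE.curl (u t) (R (WithLp.toLp 2 ![y 0, y 1, c]))) (R
      (EuclideanSpace.single 2 1))‖ₑ ≤ (⨆ c' : ℝ, ∫⁻ y : EuclideanSpace ℝ (Fin 2), ‖inner ℝ
      (Literature.Analysis.FluidPDE.curl (u t₀) (R (WithLp.toLp 2 ![y 0, y 1, c']))) (R
      (EuclideanSpace.single 2 1))‖ₑ) + (C : ENNReal) * (Filter.liminf (fun ε : ℝ => ∫⁻ τ in Set.Ioo t₀ t,
      ENNReal.ofReal (1 / Real.sqrt (ν * (t - τ))) * (∫⁻ x : EuclideanSpace ℝ (Fin 3), ENNReal.ofReal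
      (-(inner ℝ ((u τ) x) (R (EuclideanSpace.single 2 1))) * (ε ^ 2 / Real.sqrt (inner ℝ
      (Literature.Analysis.FluidPDE.curl (u τ) x) (R (EuclideanSpace.single 2 1)) ^ 2 + ε ^ 2) ^ 3) *
      (inner ℝ (Literature.Analysis.FluidPDE.curl (u τ) x) (R (EuclideanSpace.single 0 1)) * fderiv ℝ (fun
      z => inner ℝ (Literature.Analysis.FluidPDE.curl (u τ) z) (R (EuclideanSpace.single 2 1))) x (R
      (EuclideanSpace.single 0 1)) + inner ℝ (Literature.Analysis.FluidPDE.curl (u τ) x) (R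
      (EuclideanSpace.single 1 1)) * fderiv ℝ (fun z => inner ℝ (Literature.Analysis.FluidPDE.curl (u τ) z)
      (R (EuclideanSpace.single 2 1))) x (R (EuclideanSpace.single 1 1)))))) (nhdsWithin 0 (Set.Ioi 0)) +
      Filter.limsup (fun ε : ℝ => ∫⁻ τ in Set.Ioo t₀ t, ENNReal.ofReal (1 / Real.sqrt (ν * (t - τ))) * (∫⁻
      x : EuclideanSpace ℝ (Fin 3), ENNReal.ofReal (-(ε ^ 2 * fderiv ℝ (fun z => inner ℝ ((u τ) z) (R
      (EuclideanSpace.single 2 1))) x (R (EuclideanSpace.single 2 1)) / Real.sqrt (inner ℝ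
      (Literature.Analysis.FluidPDE.curl (u τ) x) (R (EuclideanSpace.single 2 1)) ^ 2 + ε ^ 2)))))
      (nhdsWithin 0 (Set.Ioi 0))) := by
  sorry

/-- **stub 3 — `stub_epsTermVanishes` [L].** The ε-term's Duhamel functional vanishes as `ε → 0⁺` on every
window `[t₀,t] ⊂ (0,T)`: `(−ε²∂ₙuₙ/F_ε(f))⁺ ≤ ε(∂ₙuₙ)⁻`, and `∇u(τ) ∈ L¹(ℝ³)` uniformly on `[t₀,t]`
(quartic spatial decay of `∇u` along the strong solution; Brandolese 2004 / Kukavica–Torres 2006). -/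
theorem stub_epsTermVanishes :
      ∀ (ν T : ℝ), 0 < ν → 0 < T → ∀ (u : ℝ → EuclideanSpace ℝ (Fin 3) → EuclideanSpace ℝ (Fin 3)) (p : ℝ →
      EuclideanSpace ℝ (Fin 3) → ℝ), Literature.Analysis.FluidPDE.IsClassicalNSSolutionOn (Set.Ico 0 T) ν 0
      u p → Literature.Analysis.FluidPDE.IsLerayHopfOn T ν 0 (u 0) u →
      Literature.Analysis.FluidPDE.HasRapidSpatialDecay (u 0) → ∀ t₀ ∈ Set.Ioo 0 T, ∀ t ∈ Set.Ico t₀ T, ∀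
      (R : EuclideanSpace ℝ (Fin 3) ≃ₗᵢ[ℝ] EuclideanSpace ℝ (Fin 3)), Filter.limsup (fun ε : ℝ => ∫⁻ τ in
      Set.Ioo t₀ t, ENNReal.ofReal (1 / Real.sqrt (ν * (t - τ))) * (∫⁻ x : EuclideanSpace ℝ (Fin 3),
      ENNReal.ofReal (-(ε ^ 2 * fderiv ℝ (fun z => inner ℝ ((u τ) z) (R (EuclideanSpace.single 2 1))) x (R
      (EuclideanSpace.single 2 1)) / Real.sqrt (inner ℝ (Literature.Analysis.FluidPDE.curl (u τ) x) (R
      (EuclideanSpace.single 2 1)) ^ 2 + ε ^ 2))))) (nhdsWithin 0 (Set.Ioi 0)) = 0 := by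
  sorry

/-- **stub 4 — `stub_positiveTimeFoldBudget` [XL, OPEN — the hardest stub].** From every positive anchor
`t₀ ∈ (0,T)` the Duhamel fold-creation functional of the FOLD TERM ALONE is bounded uniformly over frames
and `t ∈ [t₀,T)`. This is the crux's open content (census §D): on a tailed discretely self-similar blow-up
it diverges like `log(1/(T−t))`, exactly as the flux does. -/
theorem stub_positiveTimeFoldBudget :
      ∀ (ν T : ℝ), 0 < ν → 0 < T → ∀ (u : ℝ → EuclideanSpace ℝ (Fin 3) → EuclideanSpace ℝ (Fin 3)) (p : ℝ →
      EuclideanSpace ℝ (Fin 3) → ℝ), Literature.Analysis.FluidPDE.IsClassicalNSSolutionOn (Set.Ico 0 T) ν 0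
      u p → Literature.Analysis.FluidPDE.IsLerayHopfOn T ν 0 (u 0) u →
      Literature.Analysis.FluidPDE.HasRapidSpatialDecay (u 0) → ∀ t₀ ∈ Set.Ioo 0 T, ∃ B : NNReal, ∀ (R :
      EuclideanSpace ℝ (Fin 3) ≃ₗᵢ[ℝ] EuclideanSpace ℝ (Fin 3)), ∀ t ∈ Set.Ico t₀ T, Filter.liminf (fun ε :
      ℝ => ∫⁻ τ in Set.Ioo t₀ t, ENNReal.ofReal (1 / Real.sqrt (ν * (t - τ))) * (∫⁻ x : EuclideanSpace ℝ
      (Fin 3), ENNReal.ofReal (-(inner ℝ ((u τ) x) (R (EuclideanSpace.single 2 1))) * (ε ^ 2 / Real.sqrt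
      (inner ℝ (Literature.Analysis.FluidPDE.curl (u τ) x) (R (EuclideanSpace.single 2 1)) ^ 2 + ε ^ 2) ^
      3) * (inner ℝ (Literature.Analysis.FluidPDE.curl (u τ) x) (R (EuclideanSpace.single 0 1)) * fderiv ℝ
      (fun z => inner ℝ (Literature.Analysis.FluidPDE.curl (u τ) z) (R (EuclideanSpace.single 2 1))) x (R
      (EuclideanSpace.single 0 1)) + inner ℝ (Literature.Analysis.FluidPDE.curl (u τ) x) (R
      (EuclideanSpace.single 1 1)) * fderiv ℝ (fun z => inner ℝ (Literature.Analysis.FluidPDE.curl (u τ) z)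
      (R (EuclideanSpace.single 2 1))) x (R (EuclideanSpace.single 1 1)))))) (nhdsWithin 0 (Set.Ioi 0)) ≤
      (B : ENNReal) := by
  sorry

/-- **Composition, closed form** (`t₀ := T/2`, `M := ↑(A + C·B)`; monotone bookkeeping in `ℝ≥0∞`). -/
theorem planarFluxAPriori_of_stubs
    (h1 : ∀ (ν T : ℝ), 0 < ν → 0 < T → ∀ (u : ℝ → EuclideanSpace ℝ (Fin 3) → EuclideanSpace ℝ (Fin 3)) (p : ℝ →
      EuclideanSpace ℝ (Fin 3) → ℝ), Literature.Analysis.FluidPDE.IsClassicalNSSolutionOn (Set.Ico 0 T) ν 0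
      u p → Literature.Analysis.FluidPDE.IsLerayHopfOn T ν 0 (u 0) u →
      Literature.Analysis.FluidPDE.HasRapidSpatialDecay (u 0) → ∀ t₀ ∈ Set.Ico 0 T, ∃ A : NNReal, ∀ s ∈
      Set.Icc 0 t₀, ∀ (R : EuclideanSpace ℝ (Fin 3) ≃ₗᵢ[ℝ] EuclideanSpace ℝ (Fin 3)) (c : ℝ), ∫⁻ y :
      EuclideanSpace ℝ (Fin 2), ‖inner ℝ (Literature.Analysis.FluidPDE.curl (u s) (R (WithLp.toLp 2 ![y 0,
      y 1, c]))) (R (EuclideanSpace.single 2 1))‖ₑ ≤ (A : ENNReal))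
    (h2 : ∃ C : NNReal, ∀ (ν T : ℝ), 0 < ν → 0 < T → ∀ (u : ℝ → EuclideanSpace ℝ (Fin 3) → EuclideanSpace ℝ
      (Fin 3)) (p : ℝ → EuclideanSpace ℝ (Fin 3) → ℝ), Literature.Analysis.FluidPDE.IsClassicalNSSolutionOn
      (Set.Ico 0 T) ν 0 u p → Literature.Analysis.FluidPDE.IsLerayHopfOn T ν 0 (u 0) u →
      Literature.Analysis.FluidPDE.HasRapidSpatialDecay (u 0) → ∀ t₀ ∈ Set.Ioo 0 T, ∀ t ∈ Set.Ico t₀ T, ∀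
      (R : EuclideanSpace ℝ (Fin 3) ≃ₗᵢ[ℝ] EuclideanSpace ℝ (Fin 3)) (c : ℝ), ∫⁻ y : EuclideanSpace ℝ (Fin
      2), ‖inner ℝ (Literature.Analysis.FluidPDE.curl (u t) (R (WithLp.toLp 2 ![y 0, y 1, c]))) (R
      (EuclideanSpace.single 2 1))‖ₑ ≤ (⨆ c' : ℝ, ∫⁻ y : EuclideanSpace ℝ (Fin 2), ‖inner ℝ
      (Literature.Analysis.FluidPDE.curl (u t₀) (R (WithLp.toLp 2 ![y 0, y 1, c']))) (R
      (EuclideanSpace.single 2 1))‖ₑ) + (C : ENNReal) * (Filter.liminf (fun ε : ℝ => ∫⁻ τ in Set.Ioo t₀ t,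
      ENNReal.ofReal (1 / Real.sqrt (ν * (t - τ))) * (∫⁻ x : EuclideanSpace ℝ (Fin 3), ENNReal.ofReal
      (-(inner ℝ ((u τ) x) (R (EuclideanSpace.single 2 1))) * (ε ^ 2 / Real.sqrt (inner ℝ
      (Literature.Analysis.FluidPDE.curl (u τ) x) (R (EuclideanSpace.single 2 1)) ^ 2 + ε ^ 2) ^ 3) *
      (inner ℝ (Literature.Analysis.FluidPDE.curl (u τ) x) (R (EuclideanSpace.single 0 1)) * fderiv ℝ (fun
      z => inner ℝ (Literature.Analysis.FluidPDE.curl (u τ) z) (R (EuclideanSpace.single 2 1))) x (R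
      (EuclideanSpace.single 0 1)) + inner ℝ (Literature.Analysis.FluidPDE.curl (u τ) x) (R
      (EuclideanSpace.single 1 1)) * fderiv ℝ (fun z => inner ℝ (Literature.Analysis.FluidPDE.curl (u τ) z)
      (R (EuclideanSpace.single 2 1))) x (R (EuclideanSpace.single 1 1)))))) (nhdsWithin 0 (Set.Ioi 0)) +
      Filter.limsup (fun ε : ℝ => ∫⁻ τ in Set.Ioo t₀ t, ENNReal.ofReal (1 / Real.sqrt (ν * (t - τ))) * (∫⁻
      x : EuclideanSpace ℝ (Fin 3), ENNReal.ofReal (-(ε ^ 2 * fderiv ℝ (fun z => inner ℝ ((u τ) z) (R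
      (EuclideanSpace.single 2 1))) x (R (EuclideanSpace.single 2 1)) / Real.sqrt (inner ℝ
      (Literature.Analysis.FluidPDE.curl (u τ) x) (R (EuclideanSpace.single 2 1)) ^ 2 + ε ^ 2)))))
      (nhdsWithin 0 (Set.Ioi 0))))
    (h3 : ∀ (ν T : ℝ), 0 < ν → 0 < T → ∀ (u : ℝ → EuclideanSpace ℝ (Fin 3) → EuclideanSpace ℝ (Fin 3)) (p : ℝ →
      EuclideanSpace ℝ (Fin 3) → ℝ), Literature.Analysis.FluidPDE.IsClassicalNSSolutionOn (Set.Ico 0 T) ν 0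
      u p → Literature.Analysis.FluidPDE.IsLerayHopfOn T ν 0 (u 0) u →
      Literature.Analysis.FluidPDE.HasRapidSpatialDecay (u 0) → ∀ t₀ ∈ Set.Ioo 0 T, ∀ t ∈ Set.Ico t₀ T, ∀
      (R : EuclideanSpace ℝ (Fin 3) ≃ₗᵢ[ℝ] EuclideanSpace ℝ (Fin 3)), Filter.limsup (fun ε : ℝ => ∫⁻ τ in
      Set.Ioo t₀ t, ENNReal.ofReal (1 / Real.sqrt (ν * (t - τ))) * (∫⁻ x : EuclideanSpace ℝ (Fin 3),
      ENNReal.ofReal (-(ε ^ 2 * fderiv ℝ (fun z => inner ℝ ((u τ) z) (R (EuclideanSpace.single 2 1))) x (R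
      (EuclideanSpace.single 2 1)) / Real.sqrt (inner ℝ (Literature.Analysis.FluidPDE.curl (u τ) x) (R
      (EuclideanSpace.single 2 1)) ^ 2 + ε ^ 2))))) (nhdsWithin 0 (Set.Ioi 0)) = 0)
    (h4 : ∀ (ν T : ℝ), 0 < ν → 0 < T → ∀ (u : ℝ → EuclideanSpace ℝ (Fin 3) → EuclideanSpace ℝ (Fin 3)) (p : ℝ →
      EuclideanSpace ℝ (Fin 3) → ℝ), Literature.Analysis.FluidPDE.IsClassicalNSSolutionOn (Set.Ico 0 T) ν 0
      u p → Literature.Analysis.FluidPDE.IsLerayHopfOn T ν 0 (u 0) u →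
      Literature.Analysis.FluidPDE.HasRapidSpatialDecay (u 0) → ∀ t₀ ∈ Set.Ioo 0 T, ∃ B : NNReal, ∀ (R :
      EuclideanSpace ℝ (Fin 3) ≃ₗᵢ[ℝ] EuclideanSpace ℝ (Fin 3)), ∀ t ∈ Set.Ico t₀ T, Filter.liminf (fun ε :
      ℝ => ∫⁻ τ in Set.Ioo t₀ t, ENNReal.ofReal (1 / Real.sqrt (ν * (t - τ))) * (∫⁻ x : EuclideanSpace ℝ
      (Fin 3), ENNReal.ofReal (-(inner ℝ ((u τ) x) (R (EuclideanSpace.single 2 1))) * (ε ^ 2 / Real.sqrt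
      (inner ℝ (Literature.Analysis.FluidPDE.curl (u τ) x) (R (EuclideanSpace.single 2 1)) ^ 2 + ε ^ 2) ^
      3) * (inner ℝ (Literature.Analysis.FluidPDE.curl (u τ) x) (R (EuclideanSpace.single 0 1)) * fderiv ℝ
      (fun z => inner ℝ (Literature.Analysis.FluidPDE.curl (u τ) z) (R (EuclideanSpace.single 2 1))) x (R
      (EuclideanSpace.single 0 1)) + inner ℝ (Literature.Analysis.FluidPDE.curl (u τ) x) (R
      (EuclideanSpace.single 1 1)) * fderiv ℝ (fun z => inner ℝ (Literature.Analysis.FluidPDE.curl (u τ) z)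
      (R (EuclideanSpace.single 2 1))) x (R (EuclideanSpace.single 1 1)))))) (nhdsWithin 0 (Set.Ioi 0)) ≤
      (B : ENNReal)) :
    ∀ (ν T : ℝ), 0 < ν → 0 < T → ∀ (u : ℝ → EuclideanSpace ℝ (Fin 3) → EuclideanSpace ℝ (Fin 3)) (p : ℝ →
    EuclideanSpace ℝ (Fin 3) → ℝ), Literature.Analysis.FluidPDE.IsClassicalNSSolutionOn (Set.Ico 0 T) ν 0 u
    p → Literature.Analysis.FluidPDE.IsLerayHopfOn T ν 0 (u 0) u →
    Literature.Analysis.FluidPDE.HasRapidSpatialDecay (u 0) → ∃ M : ℝ, ∀ t ∈ Set.Ico 0 T, ∀ (R :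
    EuclideanSpace ℝ (Fin 3) ≃ₗᵢ[ℝ] EuclideanSpace ℝ (Fin 3)) (c : ℝ), ∫⁻ y : EuclideanSpace ℝ (Fin 2),
    ‖inner ℝ (Literature.Analysis.FluidPDE.curl (u t) (R (WithLp.toLp 2 ![y 0, y 1, c]))) (R
    (EuclideanSpace.single 2 1))‖ₑ ≤ ENNReal.ofReal M := by
  intro ν T hν hT u p hcl hLH hdec
  have ht₀ : T / 2 ∈ Set.Ioo 0 T := ⟨by positivity, by linarith⟩
  have ht₀' : T / 2 ∈ Set.Ico 0 T := ⟨by positivity, by linarith⟩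
  obtain ⟨A, hA⟩ := h1 ν T hν hT u p hcl hLH hdec (T / 2) ht₀'
  obtain ⟨C, hC⟩ := h2
  obtain ⟨B, hB⟩ := h4 ν T hν hT u p hcl hLH hdec (T / 2) ht₀
  refine ⟨((A + C * B : NNReal) : ℝ), ?_⟩
  intro t ht R c
  rw [ENNReal.ofReal_coe_nnreal, ENNReal.coe_add, ENNReal.coe_mul]
  rcases lt_or_ge t (T / 2) with hlt | hge
  · exact (hA t ⟨ht.1, hlt.le⟩ R c).trans le_self_add
  · have ht' : t ∈ Set.Ico (T / 2) T := ⟨hge, ht.2⟩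
    have hdom := hC ν T hν hT u p hcl hLH hdec (T / 2) ht₀ t ht' R c
    have heps := h3 ν T hν hT u p hcl hLH hdec (T / 2) ht₀ t ht' R
    have hbud := hB R t ht'
    refine hdom.trans ?_
    rw [heps, add_zero]
    exact add_le_add (iSup_le fun c' => hA (T / 2) ⟨ht₀.1.le, le_rfl⟩ R c') (mul_le_mul' le_rfl hbud)

/-- **The skeleton (A12 by-name form).** The crux BY NAME, modulo the four registered stubs. -/
theorem PlanarFluxAPriori_of : Theses.SlicedKelvin.PlanarFluxAPriori :=
  planarFluxAPriori_of_stubs stub_shortTimeFlux stub_reanchoredDomination stub_epsTermVanishes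
    stub_positiveTimeFoldBudget

end Summit.NavierStokesRegularity.NavierStokesRegularity.Cruxes.PlanarFluxAPriori.Reanchored

end
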